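import Literature.Analysis.FluidPDE.OseenKernelJointSmooth
import HarnessLib

/-!
# The Oseen kernel in an orthonormal frame: scalar coefficients times vector-valued slices

Analysis/FluidPDE support file (everything proved) on the discharge path of the named fact
`Literature.Analysis.FluidPDE.knss2009_local_smoothing` (Koch–Nadirashvili–Seregin–Šverák
2009, Prop. 4.1). The bilinear kernel `K(σ, z)[a, b]` of `e^{σΔ} P ∇·` (`oseenKernel`,
`oseenKernelCLM`) is expanded in an orthonormal basis `(e_α)` of `E`:

  `K(σ, z)[a, b] = Σ_{α, β} (⟪a, e_α⟫ ⟪b, e_β⟫) • K(σ, z)[e_α, e_β]`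

(`oseenKernel_eq_sum_inner_smul`), so that the Duhamel integrand
`K(ν(t-τ), x-y)[v(τ,y), w(τ,y)]` becomes a finite sum of *scalar* functions of the fields times
the *vector-valued* kernel slices `(σ, z) ↦ K(σ, z)[e_α, e_β]`, to which the joint-derivative
calculus of `OseenKernelJointSmooth.lean` / `OseenKernelJointScaling.lean` applies entry-wise
(this is KNSS's coordinate form `K_{ijk}` of the kernel, §3 (3.4) and §4 (4.3)). Also recorded:
the slices' joint derivatives are bounded by those of the operator-valued kernel
(`norm_iteratedFDeriv_oseenKernel_prod_le_CLM`) and are continuous on the half-space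
(`continuousOn_iteratedFDeriv_oseenKernel_prod`).

## References

* G. Koch, N. Nadirashvili, G. Seregin, V. Šverák, Acta Math. 203 (2009) = arXiv:0709.3599, §3
  (3.3)–(3.4), §4 (4.3). [KochNadirashviliSereginSverak2009]
-/

noncomputable section

open MeasureTheory Set Function Filter Metric Real
open _root_.Topology
open scoped RealInnerProductSpace ContDiff

namespace Literature.Analysis.FluidPDE

variable {E : Type*} [NormedAddCommGroup E] [InnerProductSpace ℝ E] [FiniteDimensional ℝ E]
  [MeasurableSpace E] [BorelSpace E]

omit [FiniteDimensional ℝ E] [MeasurableSpace E] [BorelSpace E] in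
/-- Expansion of a continuous bilinear map in finite sums: `B(Σ aᵢ)(Σ bⱼ) = Σᵢ Σⱼ B aᵢ bⱼ`.
[folklore] -/
theorem clm₂_sum_sum {ι : Type*} (s : Finset ι) (B : E →L[ℝ] E →L[ℝ] E) (a b : ι → E) :
    B (∑ i ∈ s, a i) (∑ j ∈ s, b j) = ∑ i ∈ s, ∑ j ∈ s, B (a i) (b j) := by
  rw [map_sum]
  simp_rw [map_sum, _root_.sum_apply]
  rw [Finset.sum_comm]

omit [FiniteDimensional ℝ E] [MeasurableSpace E] [BorelSpace E] in
/-- **The kernel in an orthonormal frame**: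
`K(σ, z)[a, b] = Σ_{α, β} (⟪a, e_α⟫ ⟪b, e_β⟫) • K(σ, z)[e_α, e_β]` for any orthonormal basis
`(e_α)` of `E` (bilinearity). KNSS 2009, §3 (3.4): the coordinate kernels `K_{ijk}`.
[cite: KochNadirashviliSereginSverak2009, §3 (3.3)–(3.4) (arXiv:0709.3599 p. 6)] -/
theorem oseenKernel_eq_sum_inner_smul {ι : Type*} [Fintype ι] (e : OrthonormalBasis ι ℝ E)
    (σ : ℝ) (z a b : E) :
    oseenKernel σ z a b = ∑ α, ∑ β, (⟪a, e α⟫ * ⟪b, e β⟫) • oseenKernel σ z (e α) (e β) := by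
  have ha : a = ∑ α, ⟪a, e α⟫ • e α := by
    conv_lhs => rw [← e.sum_repr' a]
    exact Finset.sum_congr rfl fun α _ => by rw [real_inner_comm]
  have hb : b = ∑ β, ⟪b, e β⟫ • e β := by
    conv_lhs => rw [← e.sum_repr' b]
    exact Finset.sum_congr rfl fun β _ => by rw [real_inner_comm]
  rw [← oseenKernelCLM_apply]
  conv_lhs => rw [ha, hb]
  rw [clm₂_sum_sum]
  refine Finset.sum_congr rfl fun α _ => Finset.sum_congr rfl fun β _ => ?_
  rw [map_smul, map_smul, smul_apply, smul_smul, oseenKernelCLM_apply, mul_comm]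

omit [FiniteDimensional ℝ E] [MeasurableSpace E] [BorelSpace E] in
/-- The frame expansion as an identity of functions of `(σ, z)`. [folklore] -/
theorem oseenKernel_prod_eq_sum_inner_smul {ι : Type*} [Fintype ι] (e : OrthonormalBasis ι ℝ E)
    (a b : E) :
    (fun r : ℝ × E => oseenKernel r.1 r.2 a b) =
      fun r : ℝ × E => ∑ α, ∑ β, (⟪a, e α⟫ * ⟪b, e β⟫) • oseenKernel r.1 r.2 (e α) (e β) :=
  funext fun r => oseenKernel_eq_sum_inner_smul e r.1 r.2 a b

/-- **Joint derivatives of the frame expansion**: on the half-space `σ > 0`,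
`D^m (K(·,·)[a,b])(q) = Σ_{α,β} (⟪a, e_α⟫ ⟪b, e_β⟫) • D^m (K(·,·)[e_α, e_β])(q)`. [folklore] -/
theorem iteratedFDeriv_oseenKernel_prod_eq_sum {ι : Type*} [Fintype ι] (e : OrthonormalBasis ι ℝ E)
    (a b : E) (m : ℕ) {q : ℝ × E} (hq : q ∈ Ioi (0 : ℝ) ×ˢ (univ : Set E)) :
    iteratedFDeriv ℝ m (fun r : ℝ × E => oseenKernel r.1 r.2 a b) q =
      ∑ α, ∑ β, (⟪a, e α⟫ * ⟪b, e β⟫) •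
        iteratedFDeriv ℝ m (fun r : ℝ × E => oseenKernel r.1 r.2 (e α) (e β)) q := by
  have hopen : IsOpen (Ioi (0 : ℝ) ×ˢ (univ : Set E)) := isOpen_Ioi.prod isOpen_univ
  have hcd : ∀ α β, ContDiffAt ℝ m (fun r : ℝ × E => oseenKernel r.1 r.2 (e α) (e β)) q :=
    fun α β => ((contDiffOn_oseenKernel_prod (E := E) (e α) (e β)).contDiffAt (hopen.mem_nhds hq)).of_le
      (by exact_mod_cast le_top)
  rw [oseenKernel_prod_eq_sum_inner_smul e a b]
  rw [iteratedFDeriv_fun_sum_apply (fun α _ => ContDiffAt.sum fun β _ => (hcd α β).const_smul _)]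
  refine Finset.sum_congr rfl fun α _ => ?_
  rw [iteratedFDeriv_fun_sum_apply (fun β _ => (hcd α β).const_smul _)]
  refine Finset.sum_congr rfl fun β _ => ?_
  exact iteratedFDeriv_const_smul_apply' (hcd α β)

/-- **Slices are bounded by the operator**: on the half-space,
`‖D^m (K(·,·)[a,b])(q)‖ ≤ ‖D^m K(q)‖ ‖a‖ ‖b‖`. [folklore] -/
theorem norm_iteratedFDeriv_oseenKernel_prod_le_CLM (m : ℕ) {q : ℝ × E}
    (hq : q ∈ Ioi (0 : ℝ) ×ˢ (univ : Set E)) (a b : E) :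
    ‖iteratedFDeriv ℝ m (fun r : ℝ × E => oseenKernel r.1 r.2 a b) q‖ ≤
      ‖iteratedFDeriv ℝ m (fun r : ℝ × E => oseenKernelCLM r.1 r.2) q‖ * ‖a‖ * ‖b‖ := by
  refine ContinuousMultilinearMap.opNorm_le_bound (by positivity) fun V => ?_
  rw [← iteratedFDeriv_oseenKernelCLM_prod_apply m hq V a b]
  calc ‖iteratedFDeriv ℝ m (fun r : ℝ × E => oseenKernelCLM r.1 r.2) q V a b‖
      ≤ ‖iteratedFDeriv ℝ m (fun r : ℝ × E => oseenKernelCLM r.1 r.2) q V a‖ * ‖b‖ :=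
        ContinuousLinearMap.le_opNorm _ _
    _ ≤ ‖iteratedFDeriv ℝ m (fun r : ℝ × E => oseenKernelCLM r.1 r.2) q V‖ * ‖a‖ * ‖b‖ :=
        mul_le_mul_of_nonneg_right (ContinuousLinearMap.le_opNorm _ _) (norm_nonneg _)
    _ ≤ (‖iteratedFDeriv ℝ m (fun r : ℝ × E => oseenKernelCLM r.1 r.2) q‖ * ∏ i, ‖V i‖) * ‖a‖ * ‖b‖ := by
        gcongr
        exact ContinuousMultilinearMap.le_opNorm _ _
    _ = ‖iteratedFDeriv ℝ m (fun r : ℝ × E => oseenKernelCLM r.1 r.2) q‖ * ‖a‖ * ‖b‖ * ∏ i, ‖V i‖ := by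
        ring

/-- **Slices of unit vectors are bounded by the operator**: for an orthonormal basis `(e_α)`,
`‖D^m (K(·,·)[e_α, e_β])(q)‖ ≤ ‖D^m K(q)‖` on the half-space. [folklore] -/
theorem norm_iteratedFDeriv_oseenKernel_prod_basis_le {ι : Type*} [Fintype ι]
    (e : OrthonormalBasis ι ℝ E) (α β : ι) (m : ℕ) {q : ℝ × E}
    (hq : q ∈ Ioi (0 : ℝ) ×ˢ (univ : Set E)) :
    ‖iteratedFDeriv ℝ m (fun r : ℝ × E => oseenKernel r.1 r.2 (e α) (e β)) q‖ ≤
      ‖iteratedFDeriv ℝ m (fun r : ℝ × E => oseenKernelCLM r.1 r.2) q‖ := by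
  have h := norm_iteratedFDeriv_oseenKernel_prod_le_CLM m hq (e α) (e β)
  rwa [e.orthonormal.norm_eq_one, e.orthonormal.norm_eq_one, mul_one, mul_one] at h

/-- **Continuity of the joint derivatives of the slices on the half-space.** [folklore] -/
theorem continuousOn_iteratedFDeriv_oseenKernel_prod (m : ℕ) (a b : E) :
    ContinuousOn (fun q : ℝ × E => iteratedFDeriv ℝ m (fun r : ℝ × E => oseenKernel r.1 r.2 a b) q)
      (Ioi (0 : ℝ) ×ˢ (univ : Set E)) := by
  have hopen : IsOpen (Ioi (0 : ℝ) ×ˢ (univ : Set E)) := isOpen_Ioi.prod isOpen_univ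
  have h := contDiffOn_oseenKernel_prod (E := E) a b |>.continuousOn_iteratedFDerivWithin (m := m)
    (by exact_mod_cast le_top) hopen.uniqueDiffOn
  exact h.congr fun p hp => (iteratedFDerivWithin_of_isOpen m hopen hp).symm

/-- **Norm of the frame sum**: `‖Σ_{α,β} c_{αβ} • T_{αβ}‖ ≤ Σ_{α,β} |c_{αβ}| ‖T_{αβ}‖`.
[folklore] -/
theorem norm_sum_sum_smul_le {ι : Type*} [Fintype ι] {F : Type*} [SeminormedAddCommGroup F]
    [NormedSpace ℝ F] (c : ι → ι → ℝ) (T : ι → ι → F) :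
    ‖∑ α, ∑ β, c α β • T α β‖ ≤ ∑ α, ∑ β, |c α β| * ‖T α β‖ := by
  refine (norm_sum_le _ _).trans (Finset.sum_le_sum fun α _ => ?_)
  refine (norm_sum_le _ _).trans (Finset.sum_le_sum fun β _ => ?_)
  rw [norm_smul, Real.norm_eq_abs]

omit [FiniteDimensional ℝ E] [MeasurableSpace E] [BorelSpace E] in
/-- The frame coefficients of two vectors are bounded by the product of their norms:
`|⟪a, e_α⟫ ⟪b, e_β⟫| ≤ ‖a‖ ‖b‖`. [folklore] -/
theorem abs_inner_mul_inner_le {ι : Type*} [Fintype ι] (e : OrthonormalBasis ι ℝ E) (a b : E)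
    (α β : ι) : |⟪a, e α⟫ * ⟪b, e β⟫| ≤ ‖a‖ * ‖b‖ := by
  rw [abs_mul]
  refine mul_le_mul ?_ ?_ (abs_nonneg _) (norm_nonneg _)
  · simpa [e.orthonormal.norm_eq_one] using abs_real_inner_le_norm a (e α)
  · simpa [e.orthonormal.norm_eq_one] using abs_real_inner_le_norm b (e β)

end Literature.Analysis.FluidPDE

end
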